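import Summits.Ventures.PercRepro.RankLevelSetRuleQThreeTerm
import Summits.Ventures.PercRepro.RankLevelSetRuleQSixFullPoly

/-!
# PercRepro — THE ROWS OF THE WHOLE-DIAGONAL PAIRING AT `k = 6` (p4, gen 22; C-044; paper proofs/P4-CELL-THREE.md §11.12)

The row condition of the whole-diagonal pairing at `k = 6` (`u = q − m`, `n = u + 6`, the weight `W₅(J)` of
RankLevelSetRuleQSixFullPoly): `(u+2)(u+3)(u+4)(u+5)(J+1)(J+2)(J+3)(J+4)·Π_{i<5}(1+i)·Π_{i<5}(u+m+J+1+i) ≤ W₅(J)·Π_{i<5}(u+2+i)·Π_{i<5}(J+1+i)`;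
its step (`six_row_step`, through `row_transfer`), the induction from the row `J = 1` (`six_row_all`) and the pairing in `ℕ`
(`pairing_choose_six`: `C(m,J')·C(q+J'+5, J'+5) ≤ [Σ_{s=0}^{4} C(n,5−s)·C(m,J'+s)]·C(q+J', J')`).  Axioms: standard.
-/

namespace PercRepro

open Finset

/-- The step `J ↦ J + 1` of the row condition at `k = 6` (`J + 1 ≤ m`, `5 ≤ u`). -/
lemma six_row_step (u m J : ℕ) (hJ : 1 ≤ J) (hJm : J + 1 ≤ m) (hu : 5 ≤ u)
    (h : (u + 2) * (u + 3) * (u + 4) * (u + 5) * (J + 1) * (J + 2) * (J + 3) * (J + 4) * (∏ i ∈ range 5, (1 + i)) * ∏ i ∈ range 5, (u + m + J + 1 + i)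
        ≤ ((u + 2) * (u + 3) * (u + 4) * (u + 5) * (J + 1) * (J + 2) * (J + 3) * (J + 4) + 5 * (u + 3) * (u + 4) * (u + 5) * (m - J) * (J + 2) * (J + 3) * (J + 4) + 20 * (u + 4) * (u + 5) * (m - J) * (m - J - 1) * (J + 3) * (J + 4) + 60 * (u + 5) * (m - J) * (m - J - 1) * (m - J - 2) * (J + 4) + 120 * (m - J) * (m - J - 1) * (m - J - 2) * (m - J - 3)) * (∏ i ∈ range 5, (u + 2 + i)) * ∏ i ∈ range 5, (J + 1 + i)) :
    (u + 2) * (u + 3) * (u + 4) * (u + 5) * (J + 1 + 1) * (J + 1 + 2) * (J + 1 + 3) * (J + 1 + 4) * (∏ i ∈ range 5, (1 + i)) * ∏ i ∈ range 5, (u + m + (J + 1) + 1 + i)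
        ≤ ((u + 2) * (u + 3) * (u + 4) * (u + 5) * (J + 1 + 1) * (J + 1 + 2) * (J + 1 + 3) * (J + 1 + 4) + 5 * (u + 3) * (u + 4) * (u + 5) * (m - (J + 1)) * (J + 1 + 2) * (J + 1 + 3) * (J + 1 + 4) + 20 * (u + 4) * (u + 5) * (m - (J + 1)) * (m - (J + 1) - 1) * (J + 1 + 3) * (J + 1 + 4) + 60 * (u + 5) * (m - (J + 1)) * (m - (J + 1) - 1) * (m - (J + 1) - 2) * (J + 1 + 4) + 120 * (m - (J + 1)) * (m - (J + 1) - 1) * (m - (J + 1) - 2) * (m - (J + 1) - 3)) * (∏ i ∈ range 5, (u + 2 + i)) * ∏ i ∈ range 5, (J + 1 + 1 + i) := by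
  have hPJ := prod_shift (J + 1) 5
  have hPq := prod_shift (u + m + J + 1) 5
  have e1 : ∏ i ∈ range 5, (u + m + J + 1 + 1 + i) = ∏ i ∈ range 5, (u + m + (J + 1) + 1 + i) :=
    Finset.prod_congr rfl (fun i _ => by ring)
  rw [e1] at hPq
  refine row_transfer _ _ _ _ _ _ _ _ _ _ (J + 1) (J + 5) (J + 1 + 5) (u + m + J + 1) (u + m + J + 1 + 5)
    (by ring) hPq hPJ h ?_ (by omega) (by omega) (by positivity)
  obtain ⟨a, rfl⟩ : ∃ a, u = a + 5 := ⟨u - 5, by omega⟩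
  obtain ⟨b, rfl⟩ : ∃ b, J = b + 1 := ⟨J - 1, by omega⟩
  rcases Nat.lt_or_ge (b + 1 + 3) m with hm4 | hm4
  · obtain ⟨c, rfl⟩ : ∃ c, m = b + 1 + 4 + c := ⟨m - (b + 1 + 4), by omega⟩
    simp only [show b + 1 + 4 + c - (b + 1) = c + 4 by omega, show b + 1 + 4 + c - (b + 1 + 1) = c + 3 by omega]
    rw [show c + 4 - 1 = c + 3 by omega, show c + 4 - 2 = c + 2 by omega, show c + 4 - 3 = c + 1 by omega,
      show c + 3 - 1 = c + 2 by omega, show c + 3 - 2 = c + 1 by omega, show c + 3 - 3 = c by omega]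
    have := six_step_nat_gen a b c
    calc ((a + 5 + 2) * (a + 5 + 3) * (a + 5 + 4) * (a + 5 + 5) * (b + 1 + 1) * (b + 1 + 2) * (b + 1 + 3) * (b + 1 + 4) + 5 * (a + 5 + 3) * (a + 5 + 4) * (a + 5 + 5) * (c + 4) * (b + 1 + 2) * (b + 1 + 3) * (b + 1 + 4) + 20 * (a + 5 + 4) * (a + 5 + 5) * (c + 4) * (c + 3) * (b + 1 + 3) * (b + 1 + 4) + 60 * (a + 5 + 5) * (c + 4) * (c + 3) * (c + 2) * (b + 1 + 4) + 120 * (c + 4) * (c + 3) * (c + 2) * (c + 1)) * (b + 1 + 5) * (a + 5 + (b + 1 + 4 + c) + (b + 1) + 1 + 5)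
        = (((a + 5) + 2) * ((a + 5) + 3) * ((a + 5) + 4) * ((a + 5) + 5) * ((b + 1) + 1) * ((b + 1) + 2) * ((b + 1) + 3) * ((b + 1) + 4) + 5 * ((a + 5) + 3) * ((a + 5) + 4) * ((a + 5) + 5) * (c + 4) * ((b + 1) + 2) * ((b + 1) + 3) * ((b + 1) + 4) + 20 * ((a + 5) + 4) * ((a + 5) + 5) * (c + 4) * (c + 3) * ((b + 1) + 3) * ((b + 1) + 4) + 60 * ((a + 5) + 5) * (c + 4) * (c + 3) * (c + 2) * ((b + 1) + 4) + 120 * (c + 4) * (c + 3) * (c + 2) * (c + 1)) * ((b + 1) + 5) * ((a + 5 + (b + 1 + 4 + c)) + (b + 1) + 6) := by ring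
      _ ≤ (((a + 5) + 2) * ((a + 5) + 3) * ((a + 5) + 4) * ((a + 5) + 5) * ((b + 1 + 1) + 1) * ((b + 1 + 1) + 2) * ((b + 1 + 1) + 3) * ((b + 1 + 1) + 4) + 5 * ((a + 5) + 3) * ((a + 5) + 4) * ((a + 5) + 5) * (c + 3) * ((b + 1 + 1) + 2) * ((b + 1 + 1) + 3) * ((b + 1 + 1) + 4) + 20 * ((a + 5) + 4) * ((a + 5) + 5) * (c + 3) * (c + 2) * ((b + 1 + 1) + 3) * ((b + 1 + 1) + 4) + 60 * ((a + 5) + 5) * (c + 3) * (c + 2) * (c + 1) * ((b + 1 + 1) + 4) + 120 * (c + 3) * (c + 2) * (c + 1) * (c)) * ((b + 1) + 6) * ((a + 5 + (b + 1 + 4 + c)) + (b + 1) + 1) := this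
      _ = ((a + 5 + 2) * (a + 5 + 3) * (a + 5 + 4) * (a + 5 + 5) * (b + 1 + 1 + 1) * (b + 1 + 1 + 2) * (b + 1 + 1 + 3) * (b + 1 + 1 + 4) + 5 * (a + 5 + 3) * (a + 5 + 4) * (a + 5 + 5) * (c + 3) * (b + 1 + 1 + 2) * (b + 1 + 1 + 3) * (b + 1 + 1 + 4) + 20 * (a + 5 + 4) * (a + 5 + 5) * (c + 3) * (c + 2) * (b + 1 + 1 + 3) * (b + 1 + 1 + 4) + 60 * (a + 5 + 5) * (c + 3) * (c + 2) * (c + 1) * (b + 1 + 1 + 4) + 120 * (c + 3) * (c + 2) * (c + 1) * (c)) * (b + 1 + 1 + 5) * (a + 5 + (b + 1 + 4 + c) + (b + 1) + 1) := by ring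
  · rcases Nat.lt_or_ge (b + 1 + 2) m with hm3 | hm3
    · have hmeq : m = b + 1 + 3 := by omega
      subst hmeq
      simp only [show b + 1 + 3 - (b + 1) = 3 by omega, show b + 1 + 3 - (b + 1 + 1) = 2 by omega, Nat.reduceSub]
      have := six_step_nat_m3 a b
      calc ((a + 5 + 2) * (a + 5 + 3) * (a + 5 + 4) * (a + 5 + 5) * (b + 1 + 1) * (b + 1 + 2) * (b + 1 + 3) * (b + 1 + 4) + 5 * (a + 5 + 3) * (a + 5 + 4) * (a + 5 + 5) * (3) * (b + 1 + 2) * (b + 1 + 3) * (b + 1 + 4) + 20 * (a + 5 + 4) * (a + 5 + 5) * (3) * (2) * (b + 1 + 3) * (b + 1 + 4) + 60 * (a + 5 + 5) * (3) * (2) * (1) * (b + 1 + 4) + 120 * (3) * (2) * (1) * (0)) * (b + 1 + 5) * (a + 5 + (b + 1 + 3) + (b + 1) + 1 + 5)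
          = (((a + 5) + 2) * ((a + 5) + 3) * ((a + 5) + 4) * ((a + 5) + 5) * ((b + 1) + 1) * ((b + 1) + 2) * ((b + 1) + 3) * ((b + 1) + 4) + 5 * ((a + 5) + 3) * ((a + 5) + 4) * ((a + 5) + 5) * (3) * ((b + 1) + 2) * ((b + 1) + 3) * ((b + 1) + 4) + 20 * ((a + 5) + 4) * ((a + 5) + 5) * (3) * (2) * ((b + 1) + 3) * ((b + 1) + 4) + 60 * ((a + 5) + 5) * (3) * (2) * (1) * ((b + 1) + 4) + 120 * (3) * (2) * (1) * (0)) * ((b + 1) + 5) * ((a + 5 + (b + 1 + 3)) + (b + 1) + 6) := by ring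
        _ ≤ (((a + 5) + 2) * ((a + 5) + 3) * ((a + 5) + 4) * ((a + 5) + 5) * ((b + 1 + 1) + 1) * ((b + 1 + 1) + 2) * ((b + 1 + 1) + 3) * ((b + 1 + 1) + 4) + 5 * ((a + 5) + 3) * ((a + 5) + 4) * ((a + 5) + 5) * (2) * ((b + 1 + 1) + 2) * ((b + 1 + 1) + 3) * ((b + 1 + 1) + 4) + 20 * ((a + 5) + 4) * ((a + 5) + 5) * (2) * (1) * ((b + 1 + 1) + 3) * ((b + 1 + 1) + 4) + 60 * ((a + 5) + 5) * (2) * (1) * (0) * ((b + 1 + 1) + 4) + 120 * (2) * (1) * (0) * (0)) * ((b + 1) + 6) * ((a + 5 + (b + 1 + 3)) + (b + 1) + 1) := this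
        _ = ((a + 5 + 2) * (a + 5 + 3) * (a + 5 + 4) * (a + 5 + 5) * (b + 1 + 1 + 1) * (b + 1 + 1 + 2) * (b + 1 + 1 + 3) * (b + 1 + 1 + 4) + 5 * (a + 5 + 3) * (a + 5 + 4) * (a + 5 + 5) * (2) * (b + 1 + 1 + 2) * (b + 1 + 1 + 3) * (b + 1 + 1 + 4) + 20 * (a + 5 + 4) * (a + 5 + 5) * (2) * (1) * (b + 1 + 1 + 3) * (b + 1 + 1 + 4) + 60 * (a + 5 + 5) * (2) * (1) * (0) * (b + 1 + 1 + 4) + 120 * (2) * (1) * (0) * (0)) * (b + 1 + 1 + 5) * (a + 5 + (b + 1 + 3) + (b + 1) + 1) := by ring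
    · rcases Nat.lt_or_ge (b + 1 + 1) m with hm2 | hm2
      · have hmeq : m = b + 1 + 2 := by omega
        subst hmeq
        simp only [show b + 1 + 2 - (b + 1) = 2 by omega, show b + 1 + 2 - (b + 1 + 1) = 1 by omega, Nat.reduceSub]
        have := six_step_nat_m2 a b
        calc ((a + 5 + 2) * (a + 5 + 3) * (a + 5 + 4) * (a + 5 + 5) * (b + 1 + 1) * (b + 1 + 2) * (b + 1 + 3) * (b + 1 + 4) + 5 * (a + 5 + 3) * (a + 5 + 4) * (a + 5 + 5) * (2) * (b + 1 + 2) * (b + 1 + 3) * (b + 1 + 4) + 20 * (a + 5 + 4) * (a + 5 + 5) * (2) * (1) * (b + 1 + 3) * (b + 1 + 4) + 60 * (a + 5 + 5) * (2) * (1) * (0) * (b + 1 + 4) + 120 * (2) * (1) * (0) * (0)) * (b + 1 + 5) * (a + 5 + (b + 1 + 2) + (b + 1) + 1 + 5)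
            = (((a + 5) + 2) * ((a + 5) + 3) * ((a + 5) + 4) * ((a + 5) + 5) * ((b + 1) + 1) * ((b + 1) + 2) * ((b + 1) + 3) * ((b + 1) + 4) + 5 * ((a + 5) + 3) * ((a + 5) + 4) * ((a + 5) + 5) * (2) * ((b + 1) + 2) * ((b + 1) + 3) * ((b + 1) + 4) + 20 * ((a + 5) + 4) * ((a + 5) + 5) * (2) * (1) * ((b + 1) + 3) * ((b + 1) + 4) + 60 * ((a + 5) + 5) * (2) * (1) * (0) * ((b + 1) + 4) + 120 * (2) * (1) * (0) * (0)) * ((b + 1) + 5) * ((a + 5 + (b + 1 + 2)) + (b + 1) + 6) := by ring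
          _ ≤ (((a + 5) + 2) * ((a + 5) + 3) * ((a + 5) + 4) * ((a + 5) + 5) * ((b + 1 + 1) + 1) * ((b + 1 + 1) + 2) * ((b + 1 + 1) + 3) * ((b + 1 + 1) + 4) + 5 * ((a + 5) + 3) * ((a + 5) + 4) * ((a + 5) + 5) * (1) * ((b + 1 + 1) + 2) * ((b + 1 + 1) + 3) * ((b + 1 + 1) + 4) + 20 * ((a + 5) + 4) * ((a + 5) + 5) * (1) * (0) * ((b + 1 + 1) + 3) * ((b + 1 + 1) + 4) + 60 * ((a + 5) + 5) * (1) * (0) * (0) * ((b + 1 + 1) + 4) + 120 * (1) * (0) * (0) * (0)) * ((b + 1) + 6) * ((a + 5 + (b + 1 + 2)) + (b + 1) + 1) := this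
          _ = ((a + 5 + 2) * (a + 5 + 3) * (a + 5 + 4) * (a + 5 + 5) * (b + 1 + 1 + 1) * (b + 1 + 1 + 2) * (b + 1 + 1 + 3) * (b + 1 + 1 + 4) + 5 * (a + 5 + 3) * (a + 5 + 4) * (a + 5 + 5) * (1) * (b + 1 + 1 + 2) * (b + 1 + 1 + 3) * (b + 1 + 1 + 4) + 20 * (a + 5 + 4) * (a + 5 + 5) * (1) * (0) * (b + 1 + 1 + 3) * (b + 1 + 1 + 4) + 60 * (a + 5 + 5) * (1) * (0) * (0) * (b + 1 + 1 + 4) + 120 * (1) * (0) * (0) * (0)) * (b + 1 + 1 + 5) * (a + 5 + (b + 1 + 2) + (b + 1) + 1) := by ring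
      · have hmeq : m = b + 1 + 1 := by omega
        subst hmeq
        simp only [show b + 1 + 1 - (b + 1) = 1 by omega, show b + 1 + 1 - (b + 1 + 1) = 0 by omega, Nat.reduceSub]
        have := six_step_nat_m1 a b
        calc ((a + 5 + 2) * (a + 5 + 3) * (a + 5 + 4) * (a + 5 + 5) * (b + 1 + 1) * (b + 1 + 2) * (b + 1 + 3) * (b + 1 + 4) + 5 * (a + 5 + 3) * (a + 5 + 4) * (a + 5 + 5) * (1) * (b + 1 + 2) * (b + 1 + 3) * (b + 1 + 4) + 20 * (a + 5 + 4) * (a + 5 + 5) * (1) * (0) * (b + 1 + 3) * (b + 1 + 4) + 60 * (a + 5 + 5) * (1) * (0) * (0) * (b + 1 + 4) + 120 * (1) * (0) * (0) * (0)) * (b + 1 + 5) * (a + 5 + (b + 1 + 1) + (b + 1) + 1 + 5)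
            = (((a + 5) + 2) * ((a + 5) + 3) * ((a + 5) + 4) * ((a + 5) + 5) * ((b + 1) + 1) * ((b + 1) + 2) * ((b + 1) + 3) * ((b + 1) + 4) + 5 * ((a + 5) + 3) * ((a + 5) + 4) * ((a + 5) + 5) * (1) * ((b + 1) + 2) * ((b + 1) + 3) * ((b + 1) + 4) + 20 * ((a + 5) + 4) * ((a + 5) + 5) * (1) * (0) * ((b + 1) + 3) * ((b + 1) + 4) + 60 * ((a + 5) + 5) * (1) * (0) * (0) * ((b + 1) + 4) + 120 * (1) * (0) * (0) * (0)) * ((b + 1) + 5) * ((a + 5 + (b + 1 + 1)) + (b + 1) + 6) := by ring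
          _ ≤ (((a + 5) + 2) * ((a + 5) + 3) * ((a + 5) + 4) * ((a + 5) + 5) * ((b + 1 + 1) + 1) * ((b + 1 + 1) + 2) * ((b + 1 + 1) + 3) * ((b + 1 + 1) + 4) + 5 * ((a + 5) + 3) * ((a + 5) + 4) * ((a + 5) + 5) * (0) * ((b + 1 + 1) + 2) * ((b + 1 + 1) + 3) * ((b + 1 + 1) + 4) + 20 * ((a + 5) + 4) * ((a + 5) + 5) * (0) * (0) * ((b + 1 + 1) + 3) * ((b + 1 + 1) + 4) + 60 * ((a + 5) + 5) * (0) * (0) * (0) * ((b + 1 + 1) + 4) + 120 * (0) * (0) * (0) * (0)) * ((b + 1) + 6) * ((a + 5 + (b + 1 + 1)) + (b + 1) + 1) := this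
          _ = ((a + 5 + 2) * (a + 5 + 3) * (a + 5 + 4) * (a + 5 + 5) * (b + 1 + 1 + 1) * (b + 1 + 1 + 2) * (b + 1 + 1 + 3) * (b + 1 + 1 + 4) + 5 * (a + 5 + 3) * (a + 5 + 4) * (a + 5 + 5) * (0) * (b + 1 + 1 + 2) * (b + 1 + 1 + 3) * (b + 1 + 1 + 4) + 20 * (a + 5 + 4) * (a + 5 + 5) * (0) * (0) * (b + 1 + 1 + 3) * (b + 1 + 1 + 4) + 60 * (a + 5 + 5) * (0) * (0) * (0) * (b + 1 + 1 + 4) + 120 * (0) * (0) * (0) * (0)) * (b + 1 + 1 + 5) * (a + 5 + (b + 1 + 1) + (b + 1) + 1) := by ring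

/-- From the row `J = 1` (the hypothesis) to every row `1 ≤ J ≤ m` of the whole-diagonal pairing at `k = 6`. -/
lemma six_row_all (u m : ℕ) (hu : 5 ≤ u)
    (h6 : (u + 2) * (u + 3) * (u + 4) * (u + 5) * ∏ i ∈ range 5, (u + m + 2 + i)
        ≤ (6 * (u + 2) * (u + 3) * (u + 4) * (u + 5) + 15 * (u + 3) * (u + 4) * (u + 5) * (m - 1) + 20 * (u + 4) * (u + 5) * (m - 1) * (m - 2)
            + 15 * (u + 5) * (m - 1) * (m - 2) * (m - 3) + 6 * (m - 1) * (m - 2) * (m - 3) * (m - 4)) * ∏ i ∈ range 5, (u + 2 + i)) :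
    ∀ J, 1 ≤ J → J ≤ m →
      (u + 2) * (u + 3) * (u + 4) * (u + 5) * (J + 1) * (J + 2) * (J + 3) * (J + 4) * (∏ i ∈ range 5, (1 + i))
          * ∏ i ∈ range 5, (u + m + J + 1 + i)
        ≤ ((u + 2) * (u + 3) * (u + 4) * (u + 5) * (J + 1) * (J + 2) * (J + 3) * (J + 4) + 5 * (u + 3) * (u + 4) * (u + 5) * (m - J) * (J + 2) * (J + 3) * (J + 4) + 20 * (u + 4) * (u + 5) * (m - J) * (m - J - 1) * (J + 3) * (J + 4) + 60 * (u + 5) * (m - J) * (m - J - 1) * (m - J - 2) * (J + 4) + 120 * (m - J) * (m - J - 1) * (m - J - 2) * (m - J - 3)) * (∏ i ∈ range 5, (u + 2 + i)) * ∏ i ∈ range 5, (J + 1 + i) := by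
  intro J hJ hJm
  induction J with
  | zero => omega
  | succ J ih =>
    rcases Nat.eq_zero_or_pos J with h0 | hpos
    · subst h0
      have e : ∏ i ∈ range 5, (0 + 1 + 1 + i) = 6 * ∏ i ∈ range 5, (1 + i) := by
        have := prod_shift 1 5
        rw [mul_one] at this
        have e' : ∏ i ∈ range 5, (0 + 1 + 1 + i) = ∏ i ∈ range 5, (1 + 1 + i) :=
          Finset.prod_congr rfl (fun i _ => by ring)
        rw [e', this]; ring
      have e2 : ∏ i ∈ range 5, (u + m + (0 + 1) + 1 + i) = ∏ i ∈ range 5, (u + m + 2 + i) :=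
        Finset.prod_congr rfl (fun i _ => by ring)
      rw [e, e2, show m - (0 + 1) - 1 = m - 2 by omega, show m - (0 + 1) - 2 = m - 3 by omega,
        show m - (0 + 1) - 3 = m - 4 by omega, show m - (0 + 1) = m - 1 by omega]
      calc (u + 2) * (u + 3) * (u + 4) * (u + 5) * (0 + 1 + 1) * (0 + 1 + 2) * (0 + 1 + 3) * (0 + 1 + 4)
            * (∏ i ∈ range 5, (1 + i)) * ∏ i ∈ range 5, (u + m + 2 + i)
          = 120 * ((u + 2) * (u + 3) * (u + 4) * (u + 5) * ∏ i ∈ range 5, (u + m + 2 + i)) * ∏ i ∈ range 5, (1 + i) := by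
            ring
        _ ≤ 120 * ((6 * (u + 2) * (u + 3) * (u + 4) * (u + 5) + 15 * (u + 3) * (u + 4) * (u + 5) * (m - 1)
              + 20 * (u + 4) * (u + 5) * (m - 1) * (m - 2) + 15 * (u + 5) * (m - 1) * (m - 2) * (m - 3)
              + 6 * (m - 1) * (m - 2) * (m - 3) * (m - 4)) * ∏ i ∈ range 5, (u + 2 + i)) * ∏ i ∈ range 5, (1 + i) :=
            Nat.mul_le_mul_right _ (Nat.mul_le_mul_left _ h6)
        _ = ((u + 2) * (u + 3) * (u + 4) * (u + 5) * (0 + 1 + 1) * (0 + 1 + 2) * (0 + 1 + 3) * (0 + 1 + 4)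
              + 5 * (u + 3) * (u + 4) * (u + 5) * (m - 1) * (0 + 1 + 2) * (0 + 1 + 3) * (0 + 1 + 4)
              + 20 * (u + 4) * (u + 5) * (m - 1) * (m - 2) * (0 + 1 + 3) * (0 + 1 + 4)
              + 60 * (u + 5) * (m - 1) * (m - 2) * (m - 3) * (0 + 1 + 4) + 120 * (m - 1) * (m - 2) * (m - 3) * (m - 4))
              * (∏ i ∈ range 5, (u + 2 + i)) * (6 * ∏ i ∈ range 5, (1 + i)) := by ring
    · exact six_row_step u m J hpos hJm hu (ih hpos (by omega))

/-- The whole-diagonal pairing at `k = 6` in `ℕ` (row `1 ≤ J' ≤ m`, `q = u + m`, `n = u + 6`). -/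
lemma pairing_choose_six (u m J' : ℕ) (hu : 5 ≤ u) (hJ : 1 ≤ J') (hJm : J' ≤ m)
    (h6 : (u + 2) * (u + 3) * (u + 4) * (u + 5) * ∏ i ∈ range 5, (u + m + 2 + i)
        ≤ (6 * (u + 2) * (u + 3) * (u + 4) * (u + 5) + 15 * (u + 3) * (u + 4) * (u + 5) * (m - 1) + 20 * (u + 4) * (u + 5) * (m - 1) * (m - 2)
            + 15 * (u + 5) * (m - 1) * (m - 2) * (m - 3) + 6 * (m - 1) * (m - 2) * (m - 3) * (m - 4)) * ∏ i ∈ range 5, (u + 2 + i)) :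
    m.choose J' * (u + m + J' + 5).choose (J' + 5)
      ≤ ((u + 6).choose 5 * m.choose J' + (u + 6).choose 4 * m.choose (J' + 1) + (u + 6).choose 3 * m.choose (J' + 2)
          + (u + 6).choose 2 * m.choose (J' + 3) + (u + 6).choose 1 * m.choose (J' + 4)) * (u + m + J').choose J' := by
  have hT := six_row_all u m hu h6 J' hJ hJm
  have hA := choose_add_mul_prod (u + m + J') J' 5
  have hB := choose_add_mul_prod (u + 1) 0 5
  rw [Nat.choose_zero_right, one_mul, zero_add, show u + 1 + 5 = u + 6 by ring] at hB
  have c1 : (u + 6).choose 5 * 5 = (u + 6).choose 4 * (u + 2) := by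
    have := Nat.choose_succ_right_eq (u + 6) 4
    rw [show u + 6 - 4 = u + 2 by omega] at this
    exact this
  have c2 : (u + 6).choose 4 * 4 = (u + 6).choose 3 * (u + 3) := by
    have := Nat.choose_succ_right_eq (u + 6) 3
    rw [show u + 6 - 3 = u + 3 by omega] at this
    exact this
  have c3 : (u + 6).choose 3 * 3 = (u + 6).choose 2 * (u + 4) := by
    have := Nat.choose_succ_right_eq (u + 6) 2
    rw [show u + 6 - 2 = u + 4 by omega] at this
    exact this
  have c4 : (u + 6).choose 2 * 2 = (u + 6).choose 1 * (u + 5) := by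
    have := Nat.choose_succ_right_eq (u + 6) 1
    rw [show u + 6 - 1 = u + 5 by omega] at this
    exact this
  have d1 : m.choose (J' + 1) * (J' + 1) = m.choose J' * (m - J') := Nat.choose_succ_right_eq m J'
  have d2 : m.choose (J' + 2) * (J' + 2) = m.choose (J' + 1) * (m - (J' + 1)) := Nat.choose_succ_right_eq m (J' + 1)
  have d3 : m.choose (J' + 3) * (J' + 3) = m.choose (J' + 2) * (m - (J' + 2)) := Nat.choose_succ_right_eq m (J' + 2)
  have d4 : m.choose (J' + 4) * (J' + 4) = m.choose (J' + 3) * (m - (J' + 3)) := Nat.choose_succ_right_eq m (J' + 3)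
  set F := (u + 2) * (u + 3) * (u + 4) * (u + 5) * (J' + 1) * (J' + 2) * (J' + 3) * (J' + 4) with hF
  have hpos : 0 < F * ((∏ i ∈ range 5, (J' + 1 + i)) * ∏ i ∈ range 5, (1 + i)) := by positivity
  refine Nat.le_of_mul_le_mul_right ?_ hpos
  have e1 : m - (J' + 1) = m - J' - 1 := by omega
  have e2 : m - (J' + 2) = m - J' - 2 := by omega
  have e3 : m - (J' + 3) = m - J' - 3 := by omega
  have k1 : (u + 6).choose 4 * m.choose (J' + 1) * F
      = (u + 6).choose 5 * m.choose J' * (5 * (u + 3) * (u + 4) * (u + 5) * (m - J') * (J' + 2) * (J' + 3) * (J' + 4)) := by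
    calc (u + 6).choose 4 * m.choose (J' + 1) * F
        = ((u + 6).choose 4 * (u + 2)) * (m.choose (J' + 1) * (J' + 1)) * ((u + 3) * (u + 4) * (u + 5) * (J' + 2) * (J' + 3) * (J' + 4)) := by
          rw [hF]; ring
      _ = ((u + 6).choose 5 * 5) * (m.choose J' * (m - J')) * ((u + 3) * (u + 4) * (u + 5) * (J' + 2) * (J' + 3) * (J' + 4)) := by
          rw [c1, d1]
      _ = (u + 6).choose 5 * m.choose J' * (5 * (u + 3) * (u + 4) * (u + 5) * (m - J') * (J' + 2) * (J' + 3) * (J' + 4)) := by ring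
  have k2 : (u + 6).choose 3 * m.choose (J' + 2) * F
      = (u + 6).choose 5 * m.choose J' * (20 * (u + 4) * (u + 5) * (m - J') * (m - J' - 1) * (J' + 3) * (J' + 4)) := by
    calc (u + 6).choose 3 * m.choose (J' + 2) * F
        = ((u + 6).choose 3 * (u + 3)) * (m.choose (J' + 2) * (J' + 2)) * ((u + 2) * (u + 4) * (u + 5) * (J' + 1) * (J' + 3) * (J' + 4)) := by
          rw [hF]; ring
      _ = ((u + 6).choose 4 * 4) * (m.choose (J' + 1) * (m - (J' + 1))) * ((u + 2) * (u + 4) * (u + 5) * (J' + 1) * (J' + 3) * (J' + 4)) := by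
          rw [c2, d2]
      _ = ((u + 6).choose 4 * (u + 2)) * (m.choose (J' + 1) * (J' + 1)) * (4 * (u + 4) * (u + 5) * (m - (J' + 1)) * (J' + 3) * (J' + 4)) := by
          ring
      _ = ((u + 6).choose 5 * 5) * (m.choose J' * (m - J')) * (4 * (u + 4) * (u + 5) * (m - (J' + 1)) * (J' + 3) * (J' + 4)) := by
          rw [c1, d1]
      _ = (u + 6).choose 5 * m.choose J' * (20 * (u + 4) * (u + 5) * (m - J') * (m - J' - 1) * (J' + 3) * (J' + 4)) := by
          rw [e1]; ring
  have k3 : (u + 6).choose 2 * m.choose (J' + 3) * F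
      = (u + 6).choose 5 * m.choose J' * (60 * (u + 5) * (m - J') * (m - J' - 1) * (m - J' - 2) * (J' + 4)) := by
    calc (u + 6).choose 2 * m.choose (J' + 3) * F
        = ((u + 6).choose 2 * (u + 4)) * (m.choose (J' + 3) * (J' + 3)) * ((u + 2) * (u + 3) * (u + 5) * (J' + 1) * (J' + 2) * (J' + 4)) := by
          rw [hF]; ring
      _ = ((u + 6).choose 3 * 3) * (m.choose (J' + 2) * (m - (J' + 2))) * ((u + 2) * (u + 3) * (u + 5) * (J' + 1) * (J' + 2) * (J' + 4)) := by
          rw [c3, d3]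
      _ = ((u + 6).choose 3 * (u + 3)) * (m.choose (J' + 2) * (J' + 2)) * (3 * (u + 2) * (u + 5) * (m - (J' + 2)) * (J' + 1) * (J' + 4)) := by
          ring
      _ = ((u + 6).choose 4 * 4) * (m.choose (J' + 1) * (m - (J' + 1))) * (3 * (u + 2) * (u + 5) * (m - (J' + 2)) * (J' + 1) * (J' + 4)) := by
          rw [c2, d2]
      _ = ((u + 6).choose 4 * (u + 2)) * (m.choose (J' + 1) * (J' + 1)) * (12 * (u + 5) * (m - (J' + 1)) * (m - (J' + 2)) * (J' + 4)) := by
          ring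
      _ = ((u + 6).choose 5 * 5) * (m.choose J' * (m - J')) * (12 * (u + 5) * (m - (J' + 1)) * (m - (J' + 2)) * (J' + 4)) := by
          rw [c1, d1]
      _ = (u + 6).choose 5 * m.choose J' * (60 * (u + 5) * (m - J') * (m - J' - 1) * (m - J' - 2) * (J' + 4)) := by
          rw [e1, e2]; ring
  have k4 : (u + 6).choose 1 * m.choose (J' + 4) * F
      = (u + 6).choose 5 * m.choose J' * (120 * (m - J') * (m - J' - 1) * (m - J' - 2) * (m - J' - 3)) := by
    calc (u + 6).choose 1 * m.choose (J' + 4) * F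
        = ((u + 6).choose 1 * (u + 5)) * (m.choose (J' + 4) * (J' + 4)) * ((u + 2) * (u + 3) * (u + 4) * (J' + 1) * (J' + 2) * (J' + 3)) := by
          rw [hF]; ring
      _ = ((u + 6).choose 2 * 2) * (m.choose (J' + 3) * (m - (J' + 3))) * ((u + 2) * (u + 3) * (u + 4) * (J' + 1) * (J' + 2) * (J' + 3)) := by
          rw [c4, d4]
      _ = ((u + 6).choose 2 * (u + 4)) * (m.choose (J' + 3) * (J' + 3)) * (2 * (u + 2) * (u + 3) * (m - (J' + 3)) * (J' + 1) * (J' + 2)) := by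
          ring
      _ = ((u + 6).choose 3 * 3) * (m.choose (J' + 2) * (m - (J' + 2))) * (2 * (u + 2) * (u + 3) * (m - (J' + 3)) * (J' + 1) * (J' + 2)) := by
          rw [c3, d3]
      _ = ((u + 6).choose 3 * (u + 3)) * (m.choose (J' + 2) * (J' + 2)) * (6 * (u + 2) * (m - (J' + 2)) * (m - (J' + 3)) * (J' + 1)) := by
          ring
      _ = ((u + 6).choose 4 * 4) * (m.choose (J' + 1) * (m - (J' + 1))) * (6 * (u + 2) * (m - (J' + 2)) * (m - (J' + 3)) * (J' + 1)) := by
          rw [c2, d2]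
      _ = ((u + 6).choose 4 * (u + 2)) * (m.choose (J' + 1) * (J' + 1)) * (24 * (m - (J' + 1)) * (m - (J' + 2)) * (m - (J' + 3))) := by
          ring
      _ = ((u + 6).choose 5 * 5) * (m.choose J' * (m - J')) * (24 * (m - (J' + 1)) * (m - (J' + 2)) * (m - (J' + 3))) := by
          rw [c1, d1]
      _ = (u + 6).choose 5 * m.choose J' * (120 * (m - J') * (m - J' - 1) * (m - J' - 2) * (m - J' - 3)) := by
          rw [e1, e2, e3]; ring
  set W := F + 5 * (u + 3) * (u + 4) * (u + 5) * (m - J') * (J' + 2) * (J' + 3) * (J' + 4)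
      + 20 * (u + 4) * (u + 5) * (m - J') * (m - J' - 1) * (J' + 3) * (J' + 4)
      + 60 * (u + 5) * (m - J') * (m - J' - 1) * (m - J' - 2) * (J' + 4) + 120 * (m - J') * (m - J' - 1) * (m - J' - 2) * (m - J' - 3)
    with hW
  have key : (u + m + J' + 5).choose (J' + 5) * F * ((∏ i ∈ range 5, (J' + 1 + i)) * ∏ i ∈ range 5, (1 + i))
      ≤ (u + 6).choose 5 * W * (u + m + J').choose J' * ((∏ i ∈ range 5, (J' + 1 + i)) * ∏ i ∈ range 5, (1 + i)) := by
    calc (u + m + J' + 5).choose (J' + 5) * F * ((∏ i ∈ range 5, (J' + 1 + i)) * ∏ i ∈ range 5, (1 + i))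
        = ((u + m + J' + 5).choose (J' + 5) * ∏ i ∈ range 5, (J' + 1 + i)) * (F * ∏ i ∈ range 5, (1 + i)) := by ring
      _ = ((u + m + J').choose J' * ∏ i ∈ range 5, (u + m + J' + 1 + i)) * (F * ∏ i ∈ range 5, (1 + i)) := by rw [hA]
      _ = (u + m + J').choose J' * (F * (∏ i ∈ range 5, (1 + i)) * ∏ i ∈ range 5, (u + m + J' + 1 + i)) := by ring
      _ ≤ (u + m + J').choose J' * (W * (∏ i ∈ range 5, (u + 2 + i)) * ∏ i ∈ range 5, (J' + 1 + i)) := by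
          rw [hW, hF]; exact Nat.mul_le_mul_left _ hT
      _ = (u + m + J').choose J' * (W * ((u + 6).choose 5 * ∏ i ∈ range 5, (1 + i)) * ∏ i ∈ range 5, (J' + 1 + i)) := by
          rw [hB]
      _ = (u + 6).choose 5 * W * (u + m + J').choose J' * ((∏ i ∈ range 5, (J' + 1 + i)) * ∏ i ∈ range 5, (1 + i)) := by ring
  calc m.choose J' * (u + m + J' + 5).choose (J' + 5) * (F * ((∏ i ∈ range 5, (J' + 1 + i)) * ∏ i ∈ range 5, (1 + i)))
      = m.choose J' * ((u + m + J' + 5).choose (J' + 5) * F * ((∏ i ∈ range 5, (J' + 1 + i)) * ∏ i ∈ range 5, (1 + i))) := by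
        ring
    _ ≤ m.choose J' * ((u + 6).choose 5 * W * (u + m + J').choose J' * ((∏ i ∈ range 5, (J' + 1 + i)) * ∏ i ∈ range 5, (1 + i))) :=
        Nat.mul_le_mul_left _ key
    _ = ((u + 6).choose 5 * m.choose J' * F
          + (u + 6).choose 5 * m.choose J' * (5 * (u + 3) * (u + 4) * (u + 5) * (m - J') * (J' + 2) * (J' + 3) * (J' + 4))
          + (u + 6).choose 5 * m.choose J' * (20 * (u + 4) * (u + 5) * (m - J') * (m - J' - 1) * (J' + 3) * (J' + 4))
          + (u + 6).choose 5 * m.choose J' * (60 * (u + 5) * (m - J') * (m - J' - 1) * (m - J' - 2) * (J' + 4))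
          + (u + 6).choose 5 * m.choose J' * (120 * (m - J') * (m - J' - 1) * (m - J' - 2) * (m - J' - 3)))
          * (u + m + J').choose J' * ((∏ i ∈ range 5, (J' + 1 + i)) * ∏ i ∈ range 5, (1 + i)) := by rw [hW]; ring
    _ = ((u + 6).choose 5 * m.choose J' * F + (u + 6).choose 4 * m.choose (J' + 1) * F + (u + 6).choose 3 * m.choose (J' + 2) * F
          + (u + 6).choose 2 * m.choose (J' + 3) * F + (u + 6).choose 1 * m.choose (J' + 4) * F)
          * (u + m + J').choose J' * ((∏ i ∈ range 5, (J' + 1 + i)) * ∏ i ∈ range 5, (1 + i)) := by rw [k1, k2, k3, k4]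
    _ = ((u + 6).choose 5 * m.choose J' + (u + 6).choose 4 * m.choose (J' + 1) + (u + 6).choose 3 * m.choose (J' + 2)
          + (u + 6).choose 2 * m.choose (J' + 3) + (u + 6).choose 1 * m.choose (J' + 4)) * (u + m + J').choose J'
          * (F * ((∏ i ∈ range 5, (J' + 1 + i)) * ∏ i ∈ range 5, (1 + i))) := by ring

end PercRepro
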